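import Mathlib.CategoryTheory.Monoidal.Closed.Types
import Mathlib.CategoryTheory.Monoidal.Closed.Cartesian
import Mathlib.CategoryTheory.Adjunction.Limits
import Mathlib.CategoryTheory.Limits.Preserves.Shapes.BinaryProducts
import Literature.AnabelianGeometry.SemiGraphs.BTempLimitsProofs
import Literature.AlgebraicGeometry.Frobenioids.QuasiTemperoidConnectedPart
import HarnessLib

/-!
# Semi-graphs of anabelioids, §3 / Appendix: `X ↦ X × A` preserves countable colimits in `B^temp(Π)`

Mochizuki, *Semi-graphs of anabelioids*, Publ. RIMS **42** (2006) 221–322, Appendix, proof of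
Theorem A.4, p. 85 (PRIMS p. 315) [cite: MochizukiSemiAnbd2006, Thm A.4 proof p.85]: "The fact that the
resulting functor `ψ^* : T₂ → T₁` preserves countable colimits (respectively, fibered products) follows
by a routine argument from the fact that `φ^*` preserves countable colimits (respectively, countable
colimits and finite limits)."  In the coequaliser presentation of `ψ^*`
(`ψ^*(X) = coeq(φ^*(X × A₂ × A₂) ⇉ φ^*(X × A₂))`, row **A4-∃** of the abc-iut cell's
`plan/L3/SUBDAG-SemiAnbd-Cor311.md`, holder's cut 2026-08-26T03:36Z, file **E2a**, seat abc-iut-w5-d220)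
the first input of that routine argument is that **`X ↦ X × A` preserves countable colimits in the
temperoid `T = B^temp(Π)`** (§3 p. 33: countable discrete sets with continuous `Π`-action), which is
what this file proves:

* `BTemp.forget_reflectsIsomorphisms` — the fibre functor `U : B^temp(Π) ⥤ Type` reflects isomorphisms
  (bijective equivariant maps are isomorphisms), hence REFLECTS countable colimits
  (`BTemp.forget_reflectsColimitsOfShape`; it preserves them, `BTempLimitsProofs.lean`);
* `BTemp.nonempty_prodFunctorObjCompForgetIso` — `U(A × X) ≅ U A × U X` naturally in `X` (`U`
  preserves binary products; `prodComparison` is natural);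
* **`BTemp.preservesColimitsOfShape_prodFunctor_obj`** — `X ↦ A ⨯ X` (`prod.functor.obj A`) preserves
  colimits of every countable shape: through `U` this is `Y ↦ U A ⨯ Y` on `Type u`, a LEFT ADJOINT
  (`Type u` is cartesian closed, Mathlib `CartesianMonoidalCategory.isLeftAdjoint_prod_functor`), after
  colimit-preserving `U`; and `U` reflects the colimit;
* **`BTemp.preservesColimitsOfShape_prodFunctor_flip_obj`** — the same for `X ↦ X ⨯ A`
  (`prod.functor.flip.obj A`, isomorphic to the former by the symmetry `prod.braiding`,
  `nonempty_prodFunctorFlipObjIso`), and `…_comp` for the iterate `X ↦ (X ⨯ A) ⨯ A`.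

No definitions (the natural isomorphisms are recorded as `Nonempty` facts); proof-only.

The binary products are taken w.r.t. ANY `HasBinaryProducts (B^temp(Π))` instance (they exist,
`BTemp.hasFiniteLimits`; instances are proof-irrelevant).  Pure category theory / `Π`-sets; nothing
refers to the IUT corpus and no side is taken on any disputed claim.
-/

open CategoryTheory CategoryTheory.Limits

namespace Literature.AnabelianGeometry.SemiGraphs

namespace BTemp

universe u

variable {G : Type u} [Group G] [TopologicalSpace G] [IsTopologicalGroup G]

/-! ### The fibre functor reflects isomorphisms and countable colimits -/

omit [IsTopologicalGroup G] in
/-- **The fibre functor `B^temp(Π) ⥤ Type` reflects isomorphisms**: an equivariant map that is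
bijective on points is an isomorphism of `B^temp(Π)`. [cite: MochizukiSemiAnbd2006, §3 p.33] -/
theorem forget_reflectsIsomorphisms :
    ((temperedAction G).ι ⋙ Action.forget (Type u) G).ReflectsIsomorphisms := by
  refine ⟨fun {X Y} f hf => ?_⟩
  have hb : Function.Bijective fun x : X.obj.V => (f.hom.hom x : Y.obj.V) :=
    (isIso_iff_bijective (((temperedAction G).ι ⋙ Action.forget (Type u) G).map f)).mp hf
  exact Literature.AlgebraicGeometry.Frobenioids.QuasiTemperoid.BTempConnected.isIso_of_bijective f hb

/-- **The fibre functor reflects colimits of every countable shape** (it preserves them,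
`BTemp.preservesColimitsOfShape_forget`, `B^temp(Π)` has them, and it reflects isomorphisms).
[cite: MochizukiSemiAnbd2006, §3 p.33] -/
theorem forget_reflectsColimitsOfShape (J : Type) [SmallCategory J] [Countable J] :
    ReflectsColimitsOfShape J ((temperedAction G).ι ⋙ Action.forget (Type u) G) := by
  haveI : HasColimitsOfShape J (BTemp G) := BTemp.hasColimitsOfShape_of_countable J
  haveI := BTemp.preservesColimitsOfShape_forget (G := G) J
  haveI := forget_reflectsIsomorphisms (G := G)
  exact reflectsColimitsOfShape_of_reflectsIsomorphisms

/-- The fibre functor reflects limits of every finite shape (same argument).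
[cite: MochizukiSemiAnbd2006, §3 p.33] -/
theorem forget_reflectsLimitsOfShape (J : Type) [SmallCategory J] [FinCategory J] :
    ReflectsLimitsOfShape J ((temperedAction G).ι ⋙ Action.forget (Type u) G) := by
  haveI : HasLimitsOfShape J (BTemp G) := BTemp.hasLimitsOfShape_of_finCategory J
  haveI := BTemp.preservesLimitsOfShape_forget (G := G) J
  haveI := forget_reflectsIsomorphisms (G := G)
  exact reflectsLimitsOfShape_of_reflectsIsomorphisms

/-! ### `U(A × X) ≅ U A × U X`, naturally in `X` -/

variable [HasBinaryProducts (BTemp G)]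

/-- **Binary products of `B^temp(Π)` are computed on underlying sets, naturally**: for the fibre functor
`U`, `U ∘ (A ⨯ −) ≅ (U A ⨯ −) ∘ U` with components the product comparison isomorphisms.
[cite: MochizukiSemiAnbd2006, §3 p.33] -/
theorem nonempty_prodFunctorObjCompForgetIso (A : BTemp G) :
    Nonempty (prod.functor.obj A ⋙ ((temperedAction G).ι ⋙ Action.forget (Type u) G) ≅
      ((temperedAction G).ι ⋙ Action.forget (Type u) G) ⋙
        prod.functor.obj (((temperedAction G).ι ⋙ Action.forget (Type u) G).obj A)) := by
  haveI := BTemp.preservesLimitsOfShape_forget (G := G) (Discrete WalkingPair)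
  refine ⟨?_⟩
  exact NatIso.ofComponents
    (fun X => PreservesLimitPair.iso ((temperedAction G).ι ⋙ Action.forget (Type u) G) A X)
    (fun {X Y} f => by
      rw [Functor.comp_map, Functor.comp_map, PreservesLimitPair.iso_hom, PreservesLimitPair.iso_hom]
      change ((temperedAction G).ι ⋙ Action.forget (Type u) G).map (prod.map (𝟙 A) f) ≫ _ =
        _ ≫ prod.map (𝟙 _) (((temperedAction G).ι ⋙ Action.forget (Type u) G).map f)
      rw [prodComparison_natural, CategoryTheory.Functor.map_id])

/-! ### `X ↦ A × X` and `X ↦ X × A` preserve countable colimits -/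

/-- **`X ↦ A ⨯ X` preserves colimits of every countable shape in `B^temp(Π)`.**  On underlying sets this
is `Y ↦ U A ⨯ Y` on `Type u`, a left adjoint (`Type u` is cartesian closed), composed with the
colimit-preserving fibre functor; and the fibre functor reflects the colimit.
[cite: MochizukiSemiAnbd2006, Thm A.4 proof p.85] -/
theorem preservesColimitsOfShape_prodFunctor_obj (A : BTemp G) (J : Type) [SmallCategory J]
    [Countable J] : PreservesColimitsOfShape J (prod.functor.obj A) := by
  let U : BTemp G ⥤ Type u := (temperedAction G).ι ⋙ Action.forget (Type u) G
  haveI : PreservesColimitsOfShape J U := BTemp.preservesColimitsOfShape_forget (G := G) J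
  haveI : ReflectsColimitsOfShape J U := forget_reflectsColimitsOfShape (G := G) J
  haveI : PreservesColimitsOfShape J (prod.functor.obj (U.obj A) : Type u ⥤ Type u) := inferInstance
  haveI : PreservesColimitsOfShape J (U ⋙ prod.functor.obj (U.obj A)) := inferInstance
  obtain ⟨e⟩ := nonempty_prodFunctorObjCompForgetIso (G := G) A
  haveI : PreservesColimitsOfShape J (prod.functor.obj A ⋙ U) := preservesColimitsOfShape_of_natIso e.symm
  exact preservesColimitsOfShape_of_reflects_of_preserves (prod.functor.obj A) U

omit [IsTopologicalGroup G] in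
/-- `X ↦ X ⨯ A` is isomorphic to `X ↦ A ⨯ X` (the symmetry of the product, natural in `X`).
[cite: MochizukiSemiAnbd2006, Thm A.4 proof p.85] -/
theorem nonempty_prodFunctorFlipObjIso (A : BTemp G) :
    Nonempty (prod.functor.flip.obj A ≅ prod.functor.obj A) :=
  ⟨NatIso.ofComponents (fun X => prod.braiding X A) (fun {X Y} f => by
    change prod.map f (𝟙 A) ≫ (prod.braiding Y A).hom = (prod.braiding X A).hom ≫ prod.map (𝟙 A) f
    rw [Limits.braid_natural])⟩

/-- **`X ↦ X ⨯ A` preserves colimits of every countable shape in `B^temp(Π)`** (the functor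
`prod.functor.flip.obj A`: `X ↦ X ⨯ A`, `f ↦ f ⨯ 𝟙_A`). [cite: MochizukiSemiAnbd2006, Thm A.4 proof p.85] -/
theorem preservesColimitsOfShape_prodFunctor_flip_obj (A : BTemp G) (J : Type) [SmallCategory J]
    [Countable J] : PreservesColimitsOfShape J (prod.functor.flip.obj A) := by
  haveI := preservesColimitsOfShape_prodFunctor_obj (G := G) A J
  obtain ⟨e⟩ := nonempty_prodFunctorFlipObjIso (G := G) A
  exact preservesColimitsOfShape_of_natIso e.symm

/-- The same for Mathlib's `CountableCategory` shapes. [cite: MochizukiSemiAnbd2006, Thm A.4 proof p.85] -/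
theorem preservesColimitsOfShape_prodFunctor_flip_obj_of_countableCategory (A : BTemp G) (J : Type)
    [SmallCategory J] [CountableCategory J] : PreservesColimitsOfShape J (prod.functor.flip.obj A) :=
  preservesColimitsOfShape_prodFunctor_flip_obj A J

/-- The same for `X ↦ A ⨯ X` and `CountableCategory` shapes. [cite: MochizukiSemiAnbd2006, Thm A.4 proof p.85] -/
theorem preservesColimitsOfShape_prodFunctor_obj_of_countableCategory (A : BTemp G) (J : Type)
    [SmallCategory J] [CountableCategory J] : PreservesColimitsOfShape J (prod.functor.obj A) :=
  preservesColimitsOfShape_prodFunctor_obj A J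

/-- **Iterating: `X ↦ (X ⨯ A) ⨯ A` preserves countable colimits** (the object `K X` of the Čech nerve of
`X × A → X`). [cite: MochizukiSemiAnbd2006, Thm A.4 proof p.85] -/
theorem preservesColimitsOfShape_prodFunctor_flip_obj_comp (A : BTemp G) (J : Type) [SmallCategory J]
    [Countable J] : PreservesColimitsOfShape J (prod.functor.flip.obj A ⋙ prod.functor.flip.obj A) := by
  haveI := preservesColimitsOfShape_prodFunctor_flip_obj (G := G) A J
  infer_instance

end BTemp

end Literature.AnabelianGeometry.SemiGraphs
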